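import Literature.Probability.Percolation.CanonicalDiscretisationTies
import Literature.Probability.LatticeModels.TriangularLatticeProofs
import HarnessLib

/-!
# The canonical triangular-lattice discretisation of the unit disc is admissible at no mesh

Topic `Probability/Percolation`; evidence file accompanying the statement finding on
crit-perc.S04 (`Literature.Probability.Percolation.convergesInLawToSLE_six_triInterface`,
`InterfaceScalingLimit.lean`) recorded in `TriInterfaceSLE.lean`, and the `δ𝕋` twin of
`CanonicalDiscretisationTies.lean` (the same phenomenon for the square-lattice data behind
crit-perc.S02). The *canonical-data rendering* of crit-perc.S04 — the body of
`convergesInLawToSLE_six_triInterface` as first vendored, restated on 2026-08-15 over all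
discretising families following this finding; (S04-can) in the module docstring of
`TriInterfaceSLE.lean` — and the tightness fact `isTightLaws_map_triInterface` (crit-perc.S26)
quantify over Dobrushin domains `D` under the guard
`∀ᶠ δ in 𝓝[>] 0, (dobrushinData D δ).IsAdmissible` on G02's canonical discrete Dobrushin data
`dobrushinData D δ = ⟨D, δ, (ab), (ba)⟩`. We prove that for the library's closed-form Dobrushin
domain `DobrushinDomain.unitDisc` (marked points `1`, `-1`; arcs the upper and lower half
circles) the canonical data are admissible on `δ𝕋` at **no** mesh
(`not_isAdmissible_dobrushinData_unitDisc`), so that the guard fails and the canonical-data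
statement holds *vacuously* at the unit disc
(`convergesInLawToSLE_six_triInterface_unitDisc_vacuous`) — whereas the printed theorem
(Camia–Newman 2007, Thm. 5; Werner 2007, Thm. 3.1; since the restatement the body of
`convergesInLawToSLE_six_triInterface`) is a statement about the disc for every admissible
choice of lattice approximation.

## The argument (tie sites of `triDiscreteArc`)

The discrete arcs `triArcA`, `triArcB` of the data are the sites of the discrete boundary
`triMeshBoundary` at least as close to `(ab)` as to `∂Ω ∖ (ab)`, resp. to `(ba)` as to
`∂Ω ∖ (ba)` (`triDiscreteArc`, comparison with `≤`), and `IsAdmissible.disjoint` asks them to be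
disjoint. Let `δ > 0` and let `v_δ = (⌈1/δ⌉ - 1, 0)` be the last site of `δ𝕋` on the non-negative
real axis inside the disc (`triEmbed (m, 0) = m`), with abscissa `r_δ = δ (⌈1/δ⌉ - 1) ∈ [0, 1)`.
Its right neighbour `(⌈1/δ⌉, 0)` has abscissa `δ ⌈1/δ⌉ ≥ 1` and lies outside the disc, so
`v_δ ∈ triMeshBoundary`, granted that `v_δ` belongs to the discrete disc `𝔻_δ = triMeshDomain 𝔻 δ`
("the largest connected component" of the mesh graph on `𝔻 ∩ δ𝕋`): we prove that this graph is
connected — every site of the disc is joined to the origin by a lattice path along which the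
quadratic form `x₀² + x₀ x₁ + x₁²` (`= |triEmbed x|²`) does not increase
(`exists_triStep_towards_zero`) — so that `𝔻_δ` is all of `𝔻 ∩ δ𝕋` (`triMeshDomain_unitDisc`).
Both closed arcs contain the marked point `1`, so both are at distance `≤ 1 - r_δ` from `r_δ`,
and every point of the unit circle is at distance `≥ 1 - r_δ` from `r_δ`, so both complements
are at distance `≥ 1 - r_δ` (these two estimates are the square-lattice file's
`infDist_lastRealSite_arc_le`, `le_infDist_lastRealSite_frontier_diff`, the mesh point being the
same real number `r_δ`). Hence `v_δ` lies in both discrete arcs: a tie, at every mesh. (For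
`δ ≤ 0` admissibility fails by `delta_pos`.)

## References

* S. Smirnov, *Critical percolation in the plane*, C. R. Acad. Sci. Paris 333 (2001), §2 (discrete
  arcs as the boundary vertices closest to the continuum arcs — the recipe of `triDiscreteArc`).
* F. Camia, C. M. Newman, Probab. Theory Related Fields 139 (2007), §4.1 and Thm. 5 (the
  approximation `(D^δ, a^δ, b^δ) → (D, a, b)` is chosen, not canonical).
* W. Werner, *Lectures on two-dimensional critical percolation* (2009), §3.1 and §3.6.
-/

noncomputable section

open MeasureTheory Filter Topology Metric Set
open scoped Real

namespace Literature.Probability.Percolation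

section CritPerc

open LatticeModels RandomPlanarGeometry

/-! ### The discrete unit disc on `δ𝕋` is all of `𝔻 ∩ δ𝕋` -/

/-- The quadratic form of the triangular lattice, `x₀² + x₀ x₁ + x₁² = |triEmbed x|²`, as an
integer. (Werner 2009, §1.) [cite: Werner2009, §1] -/
def triQ (v : Site 2) : ℤ := v 0 ^ 2 + v 0 * v 1 + v 1 ^ 2

/-- `triQ v` is the squared norm of the embedded site. [cite: Werner2009, §1] -/
theorem triQ_cast_eq_normSq (v : Site 2) : (triQ v : ℝ) = Complex.normSq (triEmbed v) := by
  rw [normSq_triEmbed, triQ]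
  push_cast
  ring

/-- The squared norm of a triangular mesh point: `‖δ · triEmbed v‖² = δ² (v₀² + v₀ v₁ + v₁²)`.
[folklore] -/
theorem norm_triMeshPoint_sq (δ : ℝ) (v : Site 2) :
    ‖triMeshPoint δ v‖ ^ 2 = δ ^ 2 * (triQ v : ℝ) := by
  rw [triMeshPoint, norm_mul, Complex.norm_real, Real.norm_eq_abs, mul_pow, sq_abs,
    Complex.sq_norm, triQ_cast_eq_normSq]

/-- The mesh vertices of the unit disc on `δ𝕋` are the sites whose mesh point has norm `< 1`.
[folklore] -/
theorem mem_triMeshVertices_unitDisc {δ : ℝ} {v : Site 2} :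
    v ∈ triMeshVertices (ball (0 : ℂ) 1) δ ↔ ‖triMeshPoint δ v‖ < 1 := by
  rw [mem_triMeshVertices_iff, mem_ball_zero_iff]

/-- The mesh vertices of the unit disc in coordinates: `δ² (v₀² + v₀ v₁ + v₁²) < 1`. [folklore] -/
theorem mem_triMeshVertices_unitDisc_iff_triQ {δ : ℝ} {v : Site 2} :
    v ∈ triMeshVertices (ball (0 : ℂ) 1) δ ↔ δ ^ 2 * (triQ v : ℝ) < 1 := by
  rw [mem_triMeshVertices_unitDisc, ← norm_triMeshPoint_sq, sq_lt_one_iff₀ (norm_nonneg _)]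

/-- The origin is a mesh vertex of the unit disc. [folklore] -/
theorem zero_mem_triMeshVertices_unitDisc (δ : ℝ) :
    (0 : Site 2) ∈ triMeshVertices (ball (0 : ℂ) 1) δ := by
  rw [mem_triMeshVertices_unitDisc_iff_triQ]
  norm_num [triQ]

/-- Two neighbours of `𝕋` whose mesh points lie in the open unit disc are joined in the triangular
mesh graph of the disc (the closed disc is convex). [folklore] -/
theorem triMeshGraph_unitDisc_adj_of_triGraph_adj {δ : ℝ} {u v : Site 2}
    (hu : u ∈ triMeshVertices (ball (0 : ℂ) 1) δ) (hv : v ∈ triMeshVertices (ball (0 : ℂ) 1) δ)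
    (h : triGraph.Adj u v) : (triMeshGraph (ball (0 : ℂ) 1) δ).Adj u v := by
  refine triMeshGraph_adj_iff.2 ⟨h, ?_⟩
  rw [closure_ball (0 : ℂ) one_ne_zero]
  rw [mem_triMeshVertices_iff] at hu hv
  exact (convex_closedBall (0 : ℂ) 1).segment_subset (ball_subset_closedBall hu)
    (ball_subset_closedBall hv)

/-- A site whose quadratic form is no larger than that of a mesh vertex of the disc is a mesh
vertex of the disc. [folklore] -/
theorem mem_triMeshVertices_unitDisc_of_triQ_le {δ : ℝ} {u v : Site 2}
    (hu : u ∈ triMeshVertices (ball (0 : ℂ) 1) δ) (h : triQ v ≤ triQ u) :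
    v ∈ triMeshVertices (ball (0 : ℂ) 1) δ := by
  rw [mem_triMeshVertices_unitDisc_iff_triQ] at hu ⊢
  have h' : (triQ v : ℝ) ≤ triQ u := by exact_mod_cast h
  exact lt_of_le_of_lt (mul_le_mul_of_nonneg_left h' (sq_nonneg δ)) hu

/-- The quadratic form after a step `+e₀`. [folklore] -/
theorem triQ_add_single_zero (v : Site 2) :
    triQ (v + Pi.single 0 1) = triQ v + 2 * v 0 + 1 + v 1 := by
  simp [triQ, Pi.add_apply]
  ring

/-- The quadratic form after a step `-e₀`. [folklore] -/
theorem triQ_sub_single_zero (v : Site 2) :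
    triQ (v + -Pi.single 0 1) = triQ v - 2 * v 0 + 1 - v 1 := by
  simp [triQ, Pi.add_apply]
  ring

/-- The quadratic form after a step `+e₁`. [folklore] -/
theorem triQ_add_single_one (v : Site 2) :
    triQ (v + Pi.single 1 1) = triQ v + 2 * v 1 + 1 + v 0 := by
  simp [triQ, Pi.add_apply]
  ring

/-- The quadratic form after a step `-e₁`. [folklore] -/
theorem triQ_sub_single_one (v : Site 2) :
    triQ (v + -Pi.single 1 1) = triQ v - 2 * v 1 + 1 - v 0 := by
  simp [triQ, Pi.add_apply]
  ring

/-- **One step towards the origin without leaving the disc.** Every site `v ≠ 0` of `𝕋` has a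
neighbour `w` along a coordinate axis with one unit less of `|v₀| + |v₁|` and no larger quadratic
form `w₀² + w₀ w₁ + w₁² ≤ v₀² + v₀ v₁ + v₁²`: step in a coordinate of the same sign as the other
one, or, when the signs differ, in the coordinate of larger absolute value. [folklore] -/
theorem exists_triStep_towards_zero (v : Site 2) (hv : v ≠ 0) :
    ∃ w : Site 2, triGraph.Adj v w ∧ (w 0).natAbs + (w 1).natAbs + 1 = (v 0).natAbs + (v 1).natAbs ∧
      triQ w ≤ triQ v := by
  have hne : v 0 ≠ 0 ∨ v 1 ≠ 0 := by
    by_contra hcon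
    push Not at hcon
    apply hv
    funext i
    fin_cases i
    · exact hcon.1
    · exact hcon.2
  -- the four candidate steps, with their arithmetic conditions
  by_cases h0m : 0 < v 0 ∧ 1 - 2 * v 0 ≤ v 1
  · refine ⟨v + -Pi.single 0 1, (triGraph_adj_iff_eq_add _ _).2 (Or.inr (Or.inl rfl)), ?_, ?_⟩
    · simp only [Pi.add_apply, Pi.neg_apply, Pi.single_eq_same,
        Pi.single_eq_of_ne (show (1 : Fin 2) ≠ 0 by decide), neg_zero, add_zero]
      omega
    · rw [triQ_sub_single_zero]
      omega
  by_cases h0p : v 0 < 0 ∧ v 1 ≤ -2 * v 0 - 1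
  · refine ⟨v + Pi.single 0 1, (triGraph_adj_iff_eq_add _ _).2 (Or.inl rfl), ?_, ?_⟩
    · simp only [Pi.add_apply, Pi.single_eq_same,
        Pi.single_eq_of_ne (show (1 : Fin 2) ≠ 0 by decide), add_zero]
      omega
    · rw [triQ_add_single_zero]
      omega
  by_cases h1m : 0 < v 1 ∧ 1 - 2 * v 1 ≤ v 0
  · refine ⟨v + -Pi.single 1 1,
      (triGraph_adj_iff_eq_add _ _).2 (Or.inr (Or.inr (Or.inr (Or.inl rfl)))), ?_, ?_⟩
    · simp only [Pi.add_apply, Pi.neg_apply, Pi.single_eq_same,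
        Pi.single_eq_of_ne (show (0 : Fin 2) ≠ 1 by decide), neg_zero, add_zero]
      omega
    · rw [triQ_sub_single_one]
      omega
  by_cases h1p : v 1 < 0 ∧ v 0 ≤ -2 * v 1 - 1
  · refine ⟨v + Pi.single 1 1, (triGraph_adj_iff_eq_add _ _).2 (Or.inr (Or.inr (Or.inl rfl))),
      ?_, ?_⟩
    · simp only [Pi.add_apply, Pi.single_eq_same,
        Pi.single_eq_of_ne (show (0 : Fin 2) ≠ 1 by decide), add_zero]
      omega
    · rw [triQ_add_single_one]
      omega
  -- the four conditions cover every `v ≠ 0`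
  exfalso
  omega

/-- Every mesh vertex of the unit disc is joined to the origin inside the triangular mesh vertex
graph (lattice path towards `0` along which `|triEmbed ·|` does not increase). [folklore] -/
theorem triMeshVertexGraph_unitDisc_reachable_zero {δ : ℝ} (v : Site 2)
    (hv : v ∈ triMeshVertices (ball (0 : ℂ) 1) δ) :
    (triMeshVertexGraph (ball (0 : ℂ) 1) δ).Reachable ⟨v, hv⟩
      ⟨0, zero_mem_triMeshVertices_unitDisc δ⟩ := by
  suffices key : ∀ n : ℕ, ∀ (v : Site 2) (hv : v ∈ triMeshVertices (ball (0 : ℂ) 1) δ),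
      (v 0).natAbs + (v 1).natAbs = n →
      (triMeshVertexGraph (ball (0 : ℂ) 1) δ).Reachable ⟨v, hv⟩
        ⟨0, zero_mem_triMeshVertices_unitDisc δ⟩ from
    key _ v hv rfl
  intro n
  induction n with
  | zero =>
    intro v hv hn
    have : v = 0 := by
      funext i
      fin_cases i
      · exact Int.natAbs_eq_zero.1 (by simp only [Fin.zero_eta]; omega)
      · exact Int.natAbs_eq_zero.1 (by simp only [Fin.mk_one]; omega)
    subst this
    rfl
  | succ n ih =>
    intro v hv hn
    have hv0 : v ≠ 0 := by
      rintro rfl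
      simp at hn
    obtain ⟨w, hadj, habs, hQ⟩ := exists_triStep_towards_zero v hv0
    have hwmem : w ∈ triMeshVertices (ball (0 : ℂ) 1) δ :=
      mem_triMeshVertices_unitDisc_of_triQ_le hv hQ
    have hn' : (w 0).natAbs + (w 1).natAbs = n := by omega
    have hadj' : (triMeshVertexGraph (ball (0 : ℂ) 1) δ).Adj ⟨v, hv⟩ ⟨w, hwmem⟩ :=
      SimpleGraph.induce_adj.2 (triMeshGraph_unitDisc_adj_of_triGraph_adj hv hwmem hadj)
    exact hadj'.reachable.trans (ih w hwmem hn')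

/-- The triangular mesh vertex graph of the unit disc is preconnected. [folklore] -/
theorem triMeshVertexGraph_unitDisc_preconnected (δ : ℝ) :
    (triMeshVertexGraph (ball (0 : ℂ) 1) δ).Preconnected := fun u v ↦
  (triMeshVertexGraph_unitDisc_reachable_zero u.1 u.2).trans
    (triMeshVertexGraph_unitDisc_reachable_zero v.1 v.2).symm

/-- **For the unit disc the discrete domain `𝔻_δ ⊆ δ𝕋`** ("the largest connected component of
the mesh graph on `𝔻 ∩ δ𝕋`", `triMeshDomain`) **is all of `𝔻 ∩ δ𝕋`.** (Smirnov 2001, §2, for the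
notion.) [folklore] -/
theorem triMeshDomain_unitDisc (δ : ℝ) :
    triMeshDomain (ball (0 : ℂ) 1) δ = triMeshVertices (ball (0 : ℂ) 1) δ := by
  refine Subset.antisymm (triMeshDomain_subset_triMeshVertices _ _) fun v hv ↦ ?_
  have hsub := (triMeshVertexGraph_unitDisc_preconnected δ).subsingleton_connectedComponent
  simp only [triMeshDomain, mem_iUnion, mem_image]
  refine ⟨(triMeshVertexGraph (ball (0 : ℂ) 1) δ).connectedComponentMk ⟨v, hv⟩, fun C' ↦ ?_,
    ⟨v, hv⟩, ?_, rfl⟩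
  · rw [Subsingleton.elim C' ((triMeshVertexGraph (ball (0 : ℂ) 1) δ).connectedComponentMk ⟨v, hv⟩)]
  · rw [SimpleGraph.ConnectedComponent.mem_supp_iff]

/-- Membership in the triangular `𝔻_δ`: `‖δ · triEmbed v‖ < 1`. [folklore] -/
theorem mem_triMeshDomain_unitDisc {δ : ℝ} {v : Site 2} :
    v ∈ triMeshDomain (ball (0 : ℂ) 1) δ ↔ ‖triMeshPoint δ v‖ < 1 := by
  rw [triMeshDomain_unitDisc, mem_triMeshVertices_unitDisc]

/-! ### The last real site is a tie site of the two discrete arcs -/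

/-- The triangular mesh point of the last real site `(⌈1/δ⌉ - 1, 0)` is the real number
`r_δ = δ (⌈1/δ⌉ - 1)` — the same point as the square-lattice mesh point of that site
(`meshPoint_lastRealSite`), since `triEmbed (m, 0) = m`. [folklore] -/
theorem triMeshPoint_lastRealSite (δ : ℝ) :
    triMeshPoint δ ((![⌈δ⁻¹⌉ - 1, 0] : Site 2)) = (↑((δ * ((⌈δ⁻¹⌉ - 1 : ℤ) : ℝ))) : ℂ) := by
  simp only [triMeshPoint, triEmbed, Matrix.cons_val_zero, Matrix.cons_val_one, Int.cast_zero,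
    zero_mul, add_zero]
  push_cast
  ring

/-- The triangular and square-lattice mesh points of the last real site coincide. [folklore] -/
theorem triMeshPoint_lastRealSite_eq_meshPoint (δ : ℝ) :
    triMeshPoint δ ((![⌈δ⁻¹⌉ - 1, 0] : Site 2)) = meshPoint δ ((![⌈δ⁻¹⌉ - 1, 0] : Site 2)) := by
  rw [triMeshPoint_lastRealSite, meshPoint_lastRealSite]

/-- The last real site is at distance `r_δ` from the centre (on `δ𝕋`). [folklore] -/
theorem norm_triMeshPoint_lastRealSite {δ : ℝ} (hδ : 0 < δ) :
    ‖triMeshPoint δ ((![⌈δ⁻¹⌉ - 1, 0] : Site 2))‖ = (δ * ((⌈δ⁻¹⌉ - 1 : ℤ) : ℝ)) := by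
  rw [triMeshPoint_lastRealSite_eq_meshPoint, norm_meshPoint_lastRealSite hδ]

/-- The last real site belongs to the triangular discrete disc `𝔻_δ = triMeshDomain 𝔻 δ`.
[folklore] -/
theorem lastRealSite_mem_triMeshDomain {δ : ℝ} (hδ : 0 < δ) :
    (![⌈δ⁻¹⌉ - 1, 0] : Site 2) ∈ triMeshDomain (ball (0 : ℂ) 1) δ := by
  rw [mem_triMeshDomain_unitDisc, norm_triMeshPoint_lastRealSite hδ]
  exact lastRealAbscissa_lt_one hδ

/-- The right neighbour `(⌈1/δ⌉, 0)` of the last real site is not in the triangular discrete disc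
(its abscissa is `δ ⌈1/δ⌉ ≥ 1`). [folklore] -/
theorem lastRealSite_succ_not_mem_triMeshDomain {δ : ℝ} (hδ : 0 < δ) :
    (![⌈δ⁻¹⌉ - 1, 0] : Site 2) + Pi.single 0 1 ∉ triMeshDomain (ball (0 : ℂ) 1) δ := by
  intro h
  have h' : ‖triMeshPoint δ ((![⌈δ⁻¹⌉ - 1, 0] : Site 2) + Pi.single 0 1)‖ < 1 :=
    mem_triMeshDomain_unitDisc.1 h
  have hre : (triMeshPoint δ ((![⌈δ⁻¹⌉ - 1, 0] : Site 2) + Pi.single 0 1)).re =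
      δ * ((⌈δ⁻¹⌉ : ℤ) : ℝ) := by
    simp only [triMeshPoint, triEmbed, Pi.add_apply, Pi.single_eq_same, Matrix.cons_val_zero,
      Matrix.cons_val_one, Pi.single_eq_of_ne (show (1 : Fin 2) ≠ 0 by decide), add_zero,
      Int.cast_zero, zero_mul, Complex.mul_re, Complex.ofReal_re, Complex.ofReal_im, zero_mul,
      sub_zero]
    push_cast
    simp
  have h1 : (1 : ℝ) ≤ ‖triMeshPoint δ ((![⌈δ⁻¹⌉ - 1, 0] : Site 2) + Pi.single 0 1)‖ :=
    (one_le_mul_ceil_inv hδ).trans (hre ▸ Complex.re_le_norm _)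
  linarith

/-- Hence the last real site is a site of the triangular discrete boundary `triMeshBoundary` of
the unit disc (a vertex of `𝔻_δ` with a `𝕋`-neighbour outside `𝔻_δ`). (Smirnov 2001, §2, for the
notion.) [folklore] -/
theorem lastRealSite_mem_triMeshBoundary {δ : ℝ} (hδ : 0 < δ) :
    (![⌈δ⁻¹⌉ - 1, 0] : Site 2) ∈ triMeshBoundary (ball (0 : ℂ) 1) δ :=
  mem_triMeshBoundary_of_adj_not_mem (lastRealSite_mem_triMeshDomain hδ)
    ((triGraph_adj_iff_eq_add _ _).2 (Or.inl rfl)) (lastRealSite_succ_not_mem_triMeshDomain hδ)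

/-- The last real site lies in the triangular discrete arc of each of the two closed arcs of the
unit disc: it is a discrete boundary site at least as close to the arc (distance `≤ 1 - r_δ`, the
arc containing `1`) as to the complementary boundary part (distance `≥ 1 - r_δ`). [folklore] -/
theorem lastRealSite_mem_triDiscreteArc {δ : ℝ} (hδ : 0 < δ) (i : Fin 2) :
    (![⌈δ⁻¹⌉ - 1, 0] : Site 2) ∈
      triDiscreteArc DobrushinDomain.unitDisc.carrier δ (DobrushinDomain.unitDisc.arc i) := by
  refine ⟨?_, ?_⟩
  · rw [unitDisc_carrier]
    exact lastRealSite_mem_triMeshBoundary hδ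
  · rw [triMeshPoint_lastRealSite_eq_meshPoint]
    exact (infDist_lastRealSite_arc_le hδ i).trans (le_infDist_lastRealSite_frontier_diff hδ i)

/-- **The canonical triangular-lattice Dobrushin data of the unit disc are admissible at no
mesh**: for every `δ`, `¬ (dobrushinData DobrushinDomain.unitDisc δ).IsAdmissible`. For `δ > 0`
the last real site `v_δ` lies in both discrete arcs `triArcA`, `triArcB`, contradicting
`IsAdmissible.disjoint`; for `δ ≤ 0`, `IsAdmissible.delta_pos` fails. (Smirnov 2001, §2, for the
discrete-arc recipe; Camia–Newman 2007, §4.1: the approximation is chosen.) [folklore] -/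
theorem not_isAdmissible_dobrushinData_unitDisc (δ : ℝ) :
    ¬ (dobrushinData DobrushinDomain.unitDisc δ).IsAdmissible := by
  intro h
  have hδ : 0 < δ := h.delta_pos
  have hA : (![⌈δ⁻¹⌉ - 1, 0] : Site 2) ∈ (dobrushinData DobrushinDomain.unitDisc δ).triArcA :=
    lastRealSite_mem_triDiscreteArc hδ 0
  have hB : (![⌈δ⁻¹⌉ - 1, 0] : Site 2) ∈ (dobrushinData DobrushinDomain.unitDisc δ).triArcB :=
    lastRealSite_mem_triDiscreteArc hδ 1
  exact Set.disjoint_left.1 h.disjoint hA hB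

/-- Consequently the admissibility guard of crit-perc.S04/S26 (triangular case),
`∀ᶠ δ in 𝓝[>] 0, (dobrushinData D δ).IsAdmissible`, **fails for the unit disc**. [folklore] -/
theorem not_eventually_isAdmissible_dobrushinData_unitDisc :
    ¬ ∀ᶠ δ in 𝓝[>] (0 : ℝ), (dobrushinData DobrushinDomain.unitDisc δ).IsAdmissible := fun h ↦ by
  obtain ⟨δ, hδ⟩ := h.exists
  exact not_isAdmissible_dobrushinData_unitDisc δ hδ

/-- **The canonical-data statement of crit-perc.S04 is vacuous at the unit disc**: the instance
`D = DobrushinDomain.unitDisc` of (S04-can) — guard `→` convergence of the canonical triangular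
interface to SLE₆ in the disc; the body of `convergesInLawToSLE_six_triInterface` until its
2026-08-15 restatement — holds trivially, because the guard is false — independently of
Smirnov's and Camia–Newman's theorem, which concerns the disc for every admissible choice of
approximation (and is, since that restatement, the body of the named fact). This is the
statement finding that motivated the restatement (printed form first recorded in
`TriInterfaceSLE.lean`). [folklore] -/
theorem convergesInLawToSLE_six_triInterface_unitDisc_vacuous :
    (∀ᶠ δ in 𝓝[>] (0 : ℝ), (dobrushinData DobrushinDomain.unitDisc δ).IsAdmissible) →
      ConvergesInLawToSLE 6 DobrushinDomain.unitDisc (Ωδ := fun _ ↦ SiteConfig (Site 2))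
        (triInterface DobrushinDomain.unitDisc) fun _ ↦ triSitePercolation half :=
  fun h ↦ (not_eventually_isAdmissible_dobrushinData_unitDisc h).elim

/-- Likewise the triangular tightness fact crit-perc.S26, `isTightLaws_map_triInterface`, is
vacuous at the unit disc. [folklore] -/
theorem isTightLaws_map_triInterface_unitDisc_vacuous :
    (∀ᶠ δ in 𝓝[>] (0 : ℝ), (dobrushinData DobrushinDomain.unitDisc δ).IsAdmissible) →
      IsTightLaws fun δ ↦ (triSitePercolation half).map (triInterface DobrushinDomain.unitDisc δ) :=
  fun h ↦ (not_eventually_isAdmissible_dobrushinData_unitDisc h).elim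

end CritPerc

end Literature.Probability.Percolation
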